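import Literature.NumberTheory.EllipticCurves.SupersingularFormalGroupLubinTate
import Literature.NumberTheory.EllipticCurves.WeierstrassFormalGroupPoints
import HarnessLib

/-!
# The Lubin–Tate `ℤ_p`-module structure of the formal group of a supersingular curve with `a_p = 0` IS
# `[a] = exp_W(a·log_W)`: `[a]_{[−p]} = [a]`, `[n]_{[−p]} = formalMul n`, `log_W ∘ [a]_{[−p]} = a·log_W`, and
# `Ŵ = F_{[−p]}` as Mathlib `FormalGroup`s (Kobayashi 2003 §8; de Shalit I §1.2, II §1.10 — proofs only)

Topic `NumberTheory/EllipticCurves` (theorems only; no definition, no named fact, no instance).  Sequel of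
`SupersingularFormalGroupLubinTate.lean` (there: for a Weierstrass equation `V/ℤ_p` with elliptic fibres and
`a = p + 1 − #Ṽ(𝔽_p) = 0`, the integral series `[−p] = exp_W(−p·log_W)` is a Lubin–Tate series `f ∈ 𝔉_{−p}` over
`(ℤ_p, π = −p, q = p²)` and `V̂ = F_f`, `formalGroupLaw_eq_ltF_of_tr_eq_zero`) and the supersingular twin of
`OrdinaryFormalGroupLubinTateModule.lean` (same proofs, with `(π, q) = (−p, p²)` instead of `(p/ϖ, p)`):

* ★ `hom_eq_of_map_eq_of_tr_eq_zero` — **`[a]_f = [a] := exp_W(a·log_W)`** for every `a ∈ ℤ_p` (both are `≡ aX` and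
  commute with `f = [−p]`: `[−p] ∘ [a] = [−pa] = [a] ∘ [−p]`, Lubin–Tate uniqueness `LubinTate.eq_hom`);
* `hom_natCast_eq_formalMul_of_tr_eq_zero` — `[n]_f = formalMul n` (so the `π^{2n} = p^{2n}`… more usefully: the
  `[p^n]`-division points of `F_f` are the formal `pⁿ`-torsion of `E`), `hom_neg_natCast_eq_of_tr_eq_zero` —
  `[−n]_f = i ∘ formalMul n`, `hom_neg_prime_eq_of_tr_eq_zero` — `[−p]_f = f` (and `f = i ∘ formalMul p` by
  `FormalGroupPadicIntEndomorphisms.eq_formalNeg_subst_formalMul_of_map_eq`);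
* `formalLog_subst_map_hom_of_tr_eq_zero` — **`log_W ∘ [a]_f = a·log_W`** (`log_W` is the normalised logarithm of the
  Lubin–Tate `ℤ_p`-module `F_f`), `formalLog_subst_map_ltF_of_tr_eq_zero` — `log_W(F_f(z₁,z₂)) = log_W z₁ + log_W z₂`;
* ★ `toFormalGroup_eq_lubinTateFormalGroup_of_tr_eq_zero` — **`V.toFormalGroup = LubinTate.formalGroup …`** as Mathlib
  `FormalGroup`s (`FormalGroup.ext`), so that the tree's two point formalisms COINCIDE on `Ŵ`: the group `Ŵ(M) = V.Pt M`
  of `WeierstrassFormalGroupPoints` (addition `LubinTate.addPt M V.toFormalGroup`, the one matched with `E₁(K)` by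
  `FormalGroupNilIdealPointsGroupIso.kernelEquivPt`) and the Lubin–Tate points `ltAdd`/`ltSMul` of `LubinTatePoints`
  (`addPt M (LubinTate.formalGroup …)`), which carry the `[a]`-action, the division points and — after base change to
  `𝒪_{ℚ_{p²}}` and the canonical isomorphism with the standard group of `−pX + X^{p²}` — the Lubin–Tate character.

Purpose (BSD summit, crux L `SmallImageLowerHalfBothSigns`, row J of `stub_charRoad_ns`; brief
`HOME/INPUT-rowJ-BRIEF-Jcurve-g18.md` (T1.1)): the local transport `j : W[p^∞] → (F/𝒪)(ψ_𝔭)` above a supersingular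
prime with `a_p = 0` reads `T_pW|_{G_{ℚ_{p²}}}` off the Lubin–Tate module `Ŵ = F_{[−p]}`.  Nothing about elliptic curves over
number fields is proved here; no summit statement is proved.

## References
* [Kobayashi2003] S. Kobayashi, Invent. Math. 152 (2003), §8 (proof of Thm. 8.4: `Ê` is the Lubin–Tate group of parameter `−p`).
* [LubinTate1965] J. Lubin, J. Tate, Ann. of Math. 81 (1965), §1 (5), Thm. 1 (9)–(11).
* [deShalit1987] E. de Shalit, *Iwasawa theory of elliptic curves with complex multiplication* (1987), I §1.2,
  II §1.10, II §4.9 (`λ_Ê`).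
* [SilvermanAEC2009] J. H. Silverman, *The Arithmetic of Elliptic Curves*, 2nd ed. (2009), IV.2.2–IV.2.3, IV.5.5.
-/

noncomputable section

open scoped Classical
open PowerSeries Literature.NumberTheory.EllipticCurves Literature.NumberTheory.GaloisRepresentations.LubinTate

namespace WeierstrassCurve

variable {p : ℕ} [hp : Fact p.Prime] (V : WeierstrassCurve ℤ_[p]) [hE : (V.map PadicInt.Coe.ringHom).IsElliptic]
  [hEt : (V.map PadicInt.toZMod).IsElliptic]
  (ha : Literature.NumberTheory.EllipticCurves.HasseManin.tr (V.map PadicInt.toZMod) = 0)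
  {P : ℤ_[p]⟦X⟧} (hP : P.map PadicInt.Coe.ringHom = (V.map PadicInt.Coe.ringHom).formalExp.subst
    (C ((-(p : ℤ_[p]) : ℤ_[p]) : ℚ_[p]) * (V.map PadicInt.Coe.ringHom).formalLog))

/-- ★ **The Lubin–Tate endomorphism `[a]_f` of `F_f = V̂` (`f = [−p]`) IS `[a] = exp_W(a·log_W)`**: for any integral
lift `Pa` of `[a]`, `LubinTate.hom _ f f a = Pa` — both are `≡ aX (mod deg 2)` and commute with `f`
(`[−p] ∘ [a] = [−pa] = [a(−p)] = [a] ∘ [−p]`), so Lubin–Tate uniqueness applies. [cite: LubinTate1965, §1 (5)]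
[cite: Kobayashi2003, §8 (proof of Thm. 8.4)] -/
theorem hom_eq_of_map_eq_of_tr_eq_zero {a : ℤ_[p]} {Pa : ℤ_[p]⟦X⟧} (hPa : Pa.map PadicInt.Coe.ringHom =
      (V.map PadicInt.Coe.ringHom).formalExp.subst (C (a : ℚ_[p]) * (V.map PadicInt.Coe.ringHom).formalLog)) :
    hom (isLTRing_neg_natCast (p := p)) (V.isLTSeries_of_tr_eq_zero ha hP) (V.isLTSeries_of_tr_eq_zero ha hP) a = Pa := by
  symm
  obtain ⟨T, hT⟩ := V.exists_map_eq_formalExp_subst_C_mul_formalLog ((-(p : ℤ_[p])) * a)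
  have hT' : T.map PadicInt.Coe.ringHom = (V.map PadicInt.Coe.ringHom).formalExp.subst
      (C ((a * (-(p : ℤ_[p])) : ℤ_[p]) : ℚ_[p]) * (V.map PadicInt.Coe.ringHom).formalLog) := by
    rw [mul_comm a]; exact hT
  refine eq_hom _ _ _ (constantCoeff_eq_zero_of_map_eq hPa) (coeff_one_eq_of_map_eq hPa) ?_
  -- `[−p] ∘ [a] = [−pa]` and `[a] ∘ [−p] = [a(−p)]`
  rw [subst_of_map_eq hP hPa hT, subst_of_map_eq hPa hP hT']

/-- **`[n]_f = formalMul n`** (`n ∈ ℕ`): the Lubin–Tate multiplication by an integer on `F_f = V̂` is the curve's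
formal multiplication-by-`n`; in particular the `[pⁿ]`-division points of `F_f` are the formal `pⁿ`-torsion of `E`.
[cite: LubinTate1965, §1 Thm. 1] [cite: SilvermanAEC2009, IV.2.3] -/
theorem hom_natCast_eq_formalMul_of_tr_eq_zero (n : ℕ) :
    hom (isLTRing_neg_natCast (p := p)) (V.isLTSeries_of_tr_eq_zero ha hP) (V.isLTSeries_of_tr_eq_zero ha hP)
      (n : ℤ_[p]) = V.formalMul n := by
  obtain ⟨Pn, hPn⟩ := V.exists_map_eq_formalExp_subst_C_mul_formalLog (n : ℤ_[p])
  rw [V.hom_eq_of_map_eq_of_tr_eq_zero ha hP hPn, eq_formalMul_of_map_eq hPn]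

/-- `[−n]_f = i ∘ formalMul n` (`n ∈ ℕ`). [cite: LubinTate1965, §1 Thm. 1] [cite: SilvermanAEC2009, IV.2.3] -/
theorem hom_neg_natCast_eq_of_tr_eq_zero (n : ℕ) :
    hom (isLTRing_neg_natCast (p := p)) (V.isLTSeries_of_tr_eq_zero ha hP) (V.isLTSeries_of_tr_eq_zero ha hP)
      (-(n : ℤ_[p])) = V.formalNeg.subst (V.formalMul n) := by
  obtain ⟨Pn, hPn⟩ := V.exists_map_eq_formalExp_subst_C_mul_formalLog (-(n : ℤ_[p]))
  rw [V.hom_eq_of_map_eq_of_tr_eq_zero ha hP hPn, eq_formalNeg_subst_formalMul_of_map_eq hPn]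

/-- `[−p]_f = f = [−p]` (the given lift), i.e. `LubinTate.hom_self_eq`; with `hom_neg_natCast_eq_of_tr_eq_zero` also
`f = i ∘ formalMul p`. [cite: LubinTate1965, §1 Thm. 1 (11)] -/
theorem hom_neg_prime_eq_of_tr_eq_zero :
    hom (isLTRing_neg_natCast (p := p)) (V.isLTSeries_of_tr_eq_zero ha hP) (V.isLTSeries_of_tr_eq_zero ha hP)
      (-(p : ℤ_[p])) = P :=
  hom_self_eq _ _

/-- ★ **`log_W ∘ [a]_f = a · log_W`**: the formal logarithm of `W = V ⊗ ℚ_p` is a logarithm of the Lubin–Tate group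
`F_f = V̂` — it linearises every `[a]_f`, `a ∈ ℤ_p` — normalised by `log_W′(0) = 1`.
[cite: deShalit1987, Ch. I §1.2, Ch. II §4.9] [cite: SilvermanAEC2009, IV.5.5] -/
theorem formalLog_subst_map_hom_of_tr_eq_zero (a : ℤ_[p]) :
    (V.map PadicInt.Coe.ringHom).formalLog.subst ((hom (isLTRing_neg_natCast (p := p))
      (V.isLTSeries_of_tr_eq_zero ha hP) (V.isLTSeries_of_tr_eq_zero ha hP) a).map PadicInt.Coe.ringHom) =
      C (a : ℚ_[p]) * (V.map PadicInt.Coe.ringHom).formalLog := by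
  obtain ⟨Pa, hPa⟩ := V.exists_map_eq_formalExp_subst_C_mul_formalLog a
  rw [V.hom_eq_of_map_eq_of_tr_eq_zero ha hP hPa, hPa]
  exact (V.map PadicInt.Coe.ringHom).formalLog_subst_formalExp_subst_C_mul_formalLog _

/-- `log_W(F(z₁, z₂)) = log_W z₁ + log_W z₂` for the Lubin–Tate group `F_f = V̂` read over `ℚ_p` (the tree's
`formalLog_subst_formalGroupLaw` transported through `formalGroupLaw_eq_ltF_of_tr_eq_zero`).
[cite: deShalit1987, Ch. I §1.2] [cite: SilvermanAEC2009, IV.5.2] -/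
theorem formalLog_subst_map_ltF_of_tr_eq_zero :
    (V.map PadicInt.Coe.ringHom).formalLog.subst ((ltF (isLTRing_neg_natCast (p := p))
      (V.isLTSeries_of_tr_eq_zero ha hP)).map PadicInt.Coe.ringHom) =
      (V.map PadicInt.Coe.ringHom).formalLog.subst (MvPowerSeries.X 0 : MvPowerSeries (Fin 2) ℚ_[p]) +
        (V.map PadicInt.Coe.ringHom).formalLog.subst (MvPowerSeries.X 1 : MvPowerSeries (Fin 2) ℚ_[p]) := by
  rw [← V.formalGroupLaw_eq_ltF_of_tr_eq_zero ha hP, map_formalGroupLaw]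
  exact (V.map PadicInt.Coe.ringHom).formalLog_subst_formalGroupLaw

omit hE in
/-- ★ **`Ŵ = F_{[−p]}` as Mathlib `FormalGroup`s**: `V.toFormalGroup` (the chord–tangent law packaged in
`WeierstrassFormalGroupPoints`) equals `LubinTate.formalGroup` of the Lubin–Tate datum `(ℤ_p, −p, p²; [−p])` — so the
group of points `V.Pt M` (addition `LubinTate.addPt M V.toFormalGroup`) and the Lubin–Tate points `ltAdd`/`ltSMul` of
`F_{[−p]}` on any nil ideal `M` are the same operations on the same set. [cite: Kobayashi2003, §8 (proof of Thm. 8.4)]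
[cite: LubinTate1965, §1 Thm. 1] -/
theorem toFormalGroup_eq_lubinTateFormalGroup_of_tr_eq_zero [hE : (V.map PadicInt.Coe.ringHom).IsElliptic] :
    V.toFormalGroup = formalGroup (isLTRing_neg_natCast (p := p)) (V.isLTSeries_of_tr_eq_zero ha hP) := by
  refine FormalGroup.ext ?_
  rw [toFormalGroup_toPowerSeries, V.formalGroupLaw_eq_ltF_of_tr_eq_zero ha hP]
  rfl

end WeierstrassCurve
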